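import Summits.BirchSwinnertonDyer.BirchSwinnertonDyer.Theorems.ByReductionTypeAtTwoAdditivePotGoodPrintZhaiIrreducibleInstancesA
import Summits.BirchSwinnertonDyer.BirchSwinnertonDyer.Theorems.GenusKolyvaginAtTwoMinimalTwinBSDTwoOrdinaryTwist
import Literature.NumberTheory.EllipticCurves.QuadraticTwistJInvariantProofs
import HarnessLib

/-!
# K4 crux `AdditiveRankZeroAtTwo` (19098), child C3″ `AdditivePotGoodLowerHalfAtTwo` (22617): the ZHAI 2016 road OFF the `2`-adic
# `j`-window — additivity at `2` is preserved by twisting with `M ≡ 1 (mod 4)` (unramified at `2`) — and the base `44A1 = [0,1,0,3,−1]`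
# (`ord₂ j = 13`, Kodaira `IV*`)

Cell `bsd-2adic`, seat `bsd-2adic-k4-w2` GEN 6 (prover, explicit unit, no kit); `--supports stmt-BirchSwinnertonDyer-22617 --as helper`;
sequel of `…PrintZhaiIrreducible{,Corrected,InstancesA…E}.lean`. HONEST FRAMING (D-0036/D-0054): the instance files used k4-w1's
`2`-adic `j`-window (`1 ≤ ord₂ j ≤ 11` forces additive potentially good reduction at `2` for EVERY model) to decide the habitat of the
twists; bases with `ord₂ j = 0` or `≥ 12` (e.g. `44A1`: `ord₂ j = 13`, additive `IV*` at `2`) were out of reach. Here the habitat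
transport is done structurally: for `d ≡ 1 (mod 4)` the twist is unramified at `2`, and a global minimal model of `V^{(d)}` has good
reduction at `2` iff `V` does (the tree's `hasGoodReductionAtPrime_two_of_smul_quadraticTwist_of_emod_four_eq_one`, applied to the
INVERSE twist `(V^{(d)})^{(d)} ≅ V`), so `Addv V 2 ∧ 0 ≤ ord₂ j(V)` ⇒ `Addv W 2 ∧ 0 ≤ ord₂ j(W)` (multiplicative reduction is
excluded by `ord₂ j ≥ 0`). KERNEL for `44A1`: minimality, `Addv` at `2` from the integer model (`2 ∣ Δ`, `2 ∣ c₄`), `ord₂ j = 13 ≥ 0`,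
non-CM (multiplicative at `11`), `E[2]` irreducible, `N ∣ 2816 ≤ 130000`; the member `44A1^{(−3)}` (`a₃ = 1` odd ⇒ `3` inert).
DISPLAYED: the optimality datum and the record `ord₂(L(44A1,1)/Ω_∞) = 0` (Cremona 1992 Table 1: `N = 44 = 2²·11`, `r = 0`, `#T = 3`,
`c_p = (3, 1)`, `IV*, I₁`; Table 4: `S = 1`; `L/Ω_BSD = 3/9`). BY NAME: Zhai 2016 Thm. 1.1 (corrected), ARS Thm. 2.6, modularity.
Closes nothing at the `∀`-level; nothing booked; BSD is not proved by any of this.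
References: [Zhai2016] Thm. 1.1; [SilvermanAEC2009] VII.5 Prop. 5.1, X.5 Cor. 5.4.1; [CremonaAlgorithms1997] Tables 1, 4; [Miller2011LMS] Def. 1.1.
-/

set_option autoImplicit false
set_option linter.dupNamespace false

noncomputable section

open scoped Classical

open WeierstrassCurve Literature.NumberTheory.EllipticCurves
  Literature.NumberTheory.EllipticCurves.ModularForms
  Literature.NumberTheory.EllipticCurves.Rank1Residual
  Literature.NumberTheory.EllipticCurves.Rank1Residual.Typed
  Literature.NumberTheory.EllipticCurves.CoatesLiTianZhai2015
  Literature.NumberTheory.EllipticCurves.Zhai2016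
  Literature.NumberTheory.EllipticCurves.AgasheRibetStein2006
  Summit.BirchSwinnertonDyer
  Summit.BirchSwinnertonDyer.Rank1Residual
  Summit.BirchSwinnertonDyer.Rank1Residual.X11b
  Summit.BirchSwinnertonDyer.Rank1Residual.X5.O1
  Summit.BirchSwinnertonDyer.Rank1Residual.P2
  Summit.BirchSwinnertonDyer.BirchSwinnertonDyer.Rank1Residual.IntModel
  Summit.BirchSwinnertonDyer.BirchSwinnertonDyer.Theorems

namespace Summit.BirchSwinnertonDyer.BirchSwinnertonDyer.Theorems.AddPotGoodPrint

/-! ## §1 The inverse twist: `V` is a model of `W^{(d)}` when `W` is a model of `V^{(d)}` -/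

/-- **Twisting twice by `d` comes back**: if `C • V^{(d)} = W` (`d ≠ 0`) then `C₀ • W^{(d)} = V` for some change of variables `C₀`
(`(C • V^{(d)})^{(d)} = C' • V^{(d²)}` by `quadraticTwist_smul` / `quadraticTwist_quadraticTwist`, and `V^{(d²)} ≅ V^{(1)} ≅ V`).
[cite: SilvermanAEC2009, X.5 Cor. 5.4.1] -/
theorem exists_variableChange_smul_twist_twist (V W : WeierstrassCurve ℚ) {d : ℚ} (hd : d ≠ 0)
    (hW : ∃ C : VariableChange ℚ, C • V.quadraticTwist d = W) :
    ∃ C₀ : VariableChange ℚ, C₀ • W.quadraticTwist d = V := by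
  obtain ⟨C, rfl⟩ := hW
  -- `(C • V^{(d)})^{(d)} = C₁ • (V^{(d)})^{(d)} = C₁ • V^{(d·d)}`
  have h1 : (C • V.quadraticTwist d).quadraticTwist d =
      (⟨C.u, d * C.r, 0, 0⟩ : VariableChange ℚ) • V.quadraticTwist (d * d) := by
    rw [quadraticTwist_smul, quadraticTwist_quadraticTwist]
  -- `C₂ • V^{(1)} = V^{(1·d²)}` and `C₃ • V = V^{(1)}`
  obtain ⟨C₂, hC₂⟩ := V.exists_variableChange_quadraticTwist_mul_sq 1 d hd
  obtain ⟨C₃, hC₃⟩ := V.exists_variableChange_quadraticTwist_one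
  refine ⟨C₃⁻¹ * C₂⁻¹ * (⟨C.u, d * C.r, 0, 0⟩ : VariableChange ℚ)⁻¹, ?_⟩
  rw [h1, mul_smul, mul_smul, inv_smul_smul, show d * d = 1 * d ^ 2 by ring, ← hC₂, inv_smul_smul, ← hC₃, inv_smul_smul]

/-! ## §2 Additive potentially good reduction at `2` survives the unramified twist -/

/-- **`Addv` at `2` and `0 ≤ ord₂ j` pass to every global minimal model of `V^{(d)}`, `d ≡ 1 (mod 4)`.** If `W` (global minimal
model of `V^{(d)}`) had good reduction at `2`, so would `V` (a global minimal model of `W^{(d)}`, §1) by the tree's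
`hasGoodReductionAtPrime_two_of_smul_quadraticTwist_of_emod_four_eq_one`; multiplicative reduction is excluded by `ord₂ j(W) = ord₂ j(V) ≥ 0`.
[cite: SilvermanAEC2009, VII.5 Prop. 5.1 and X.5 Cor. 5.4.1] -/
theorem addv_two_of_smul_quadraticTwist_of_emod_four_eq_one (V : WeierstrassCurve ℚ) [V.IsElliptic] [V.IsGloballyMinimal]
    (hadd : haveI : Fact (Nat.Prime 2) := ⟨Nat.prime_two⟩; Addv V 2) (hj : 0 ≤ padicValRat 2 V.j)
    {d : ℤ} (hd4 : d % 4 = 1) (hd0 : d ≠ 0) (W : WeierstrassCurve ℚ) [W.IsElliptic] [W.IsGloballyMinimal]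
    (hW : ∃ C : VariableChange ℚ, C • V.quadraticTwist (d : ℚ) = W) :
    haveI : Fact (Nat.Prime 2) := ⟨Nat.prime_two⟩
    Addv W 2 ∧ 0 ≤ padicValRat 2 W.j := by
  haveI : Fact (Nat.Prime 2) := ⟨Nat.prime_two⟩
  have hdq : (d : ℚ) ≠ 0 := by exact_mod_cast hd0
  haveI := V.isElliptic_quadraticTwist hdq
  have hjW : W.j = V.j := by
    obtain ⟨C, rfl⟩ := hW
    rw [variableChange_j, j_quadraticTwist V hdq]
  refine ⟨⟨fun hgood => hadd.1 ?_, fun hmult => ?_⟩, by rw [hjW]; exact hj⟩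
  · obtain ⟨C₀, hC₀⟩ := exists_variableChange_smul_twist_twist V W hdq hW
    exact OrdinaryTwistAtTwo.hasGoodReductionAtPrime_two_of_smul_quadraticTwist_of_emod_four_eq_one W V hd4 hC₀ hgood
  · have h := EisensteinPrimes.padicValRat_j_neg_of_mult W 2 hmult
    rw [hjW] at h
    exact absurd hj (not_le.mpr h)

/-- **HABITAT of every global minimal twist by `d ≡ 1 (mod 4)`** from the habitat of the base: `Addv`, `0 ≤ ord₂ j`, `¬CM`, `Irr` all
transport (`j(W) = j(V)`, `P2.irr_two_iff_of_twist`). [cite: SilvermanAEC2009, VII.5, X.5, App. C §11] -/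
theorem habitat_twist_of_addv (V : WeierstrassCurve ℚ) [V.IsElliptic] [V.IsGloballyMinimal]
    (hadd : haveI : Fact (Nat.Prime 2) := ⟨Nat.prime_two⟩; Addv V 2) (hj : 0 ≤ padicValRat 2 V.j) (hcm : ¬ V.HasCM)
    (hirr : haveI : Fact (Nat.Prime 2) := ⟨Nat.prime_two⟩; Irr V 2)
    {d : ℤ} (hd4 : d % 4 = 1) (hd0 : d ≠ 0) (W : WeierstrassCurve ℚ) [W.IsElliptic] [W.IsGloballyMinimal]
    (hW : ∃ C : VariableChange ℚ, C • V.quadraticTwist (d : ℚ) = W) :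
    haveI : Fact (Nat.Prime 2) := ⟨Nat.prime_two⟩
    Addv W 2 ∧ 0 ≤ padicValRat 2 W.j ∧ ¬ W.HasCM ∧ Irr W 2 := by
  haveI : Fact (Nat.Prime 2) := ⟨Nat.prime_two⟩
  have hdq : (d : ℚ) ≠ 0 := by exact_mod_cast hd0
  haveI := V.isElliptic_quadraticTwist hdq
  obtain ⟨hA, hJ⟩ := addv_two_of_smul_quadraticTwist_of_emod_four_eq_one V hadd hj hd4 hd0 W hW
  have hirrW : Irr W 2 := (irr_two_iff_of_twist V hdq hW).mp hirr
  have hjW : W.j = V.j := by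
    obtain ⟨C, rfl⟩ := hW
    rw [variableChange_j, j_quadraticTwist V hdq]
  refine ⟨hA, hJ, fun hW' => hcm ?_, hirrW⟩
  exact (WeierstrassCurve.hasCM_iff_j_mem_holds V).mpr (hjW ▸ (WeierstrassCurve.hasCM_iff_j_mem_holds W).mp hW')

/-! ## §3 The corrected Zhai-1.1 road keyed on `Addv V 2` instead of the `j`-window -/

/-- **CORRECTED ZHAI-1.1 ROAD, habitat from `Addv V 2` (no `j`-window)**: for an `X₀(N)`-optimal base `V` (datum displayed), `Δ(V) < 0`,
`V[2]` irreducible, `V` ADDITIVE at `2` with `0 ≤ ord₂ j` (potentially good), non-CM, level `N ≤ 130000` (for ARS Thm. 2.6), and the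
record `ord₂(L(V,1)/Ω_∞(V)) = 0`: at every global minimal `W ≅ V^{(M)}` (`M` as in Zhai's Thm. 1.1; note `M ≡ 1 (mod 4)`):
`r_an(W) = 0 ∧ Addv W 2 ∧ 0 ≤ ord₂ j(W) ∧ ¬CM ∧ Irr W 2 ∧ MissingLowerBoundAt W 2`. BSD is not proved by any of this.
[cite: Zhai2016, Thm. 1.1 (arXiv v2)] [cite: AgasheRibetStein2006, Thm. 2.6] [cite: Miller2011LMS, Def. 1.1] -/
theorem printFamilyZhai11'_lower_of_addv (h11 : thm11_ordTwo_LAlg_twist_eq_zero')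
    (h26 : cremona_abs_maninConstant_eq_one_of_level_le) (hmod : hasEntireLFunction_rat)
    (V : WeierstrassCurve ℚ) [V.IsElliptic] [V.IsGloballyMinimal] [NeZero (V.conductorNorm ℤ)]
    (hN : V.conductorNorm ℤ ≤ 130000)
    (Dt : ModularParametrizationData V (V.conductorNorm ℤ)) (hopt : Zhai2021.IsOptimalDatum V Dt)
    (hΔ : V.Δ < 0) (hirr : haveI : Fact (Nat.Prime 2) := ⟨Nat.prime_two⟩; Irr V 2)
    (hadd : haveI : Fact (Nat.Prime 2) := ⟨Nat.prime_two⟩; Addv V 2) (hj : 0 ≤ padicValRat 2 V.j) (hcm : ¬ V.HasCM)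
    (hL : ∃ x : ℚ, IsLAlg V x ∧ x ≠ 0 ∧ padicValRat 2 x = 0)
    (F : Type) [Field F] [NumberField F] (hF : IsTwoDivisionField V F)
    (M : ℤ) (hsq : Squarefree M) (hM4 : M % 4 = 1) (hgcd : Int.gcd M (V.conductorNorm ℤ) = 1)
    (hne : M.natAbs.primeFactors.Nonempty) (hin : ∀ q ∈ M.natAbs.primeFactors, q ≠ 2 ∧ IsInertIn F q)
    (W : WeierstrassCurve ℚ) [W.IsElliptic] [W.IsGloballyMinimal]
    (hW : ∃ C : VariableChange ℚ, C • V.quadraticTwist (M : ℚ) = W) :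
    haveI : Fact (Nat.Prime 2) := ⟨Nat.prime_two⟩
    W.analyticRank = 0 ∧ Addv W 2 ∧ 0 ≤ padicValRat 2 W.j ∧ ¬ W.HasCM ∧ Irr W 2 ∧ MissingLowerBoundAt W 2 := by
  haveI : Fact (Nat.Prime 2) := ⟨Nat.prime_two⟩
  obtain ⟨hr, hlow⟩ := zhai11'_lower h11 hmod V Dt hopt (not_two_dvd_c_of_level_le h26 V Dt hopt hN) hΔ hirr hL F hF M hsq hM4
    hgcd hne hin W hW
  obtain ⟨hA, hJ, hcmW, hirrW⟩ := habitat_twist_of_addv V hadd hj hcm hirr hM4 hsq.ne_zero W hW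
  exact ⟨hr, hA, hJ, hcmW, hirrW, hlow⟩

/-! ## §4 The base `44A1` (off the window) -/

/-! ## Base `44A1` = `[0, 1, 0, 3, -1]` (Cremona 1992 Table 1: `N = 44 = 2²·11`, `r = 0`, `#T = 3`, `c_p = (3, 1)`, Kodaira `IV*, I₁`;
Table 4: `S = 1`), `Δ = -2816` (-), `j = 8192/11` (`ord₂ j = 13`), Zhai Thm. 1.1 -/
section Base44A1

/-- `44A1 = [0, 1, 0, 3, -1]` is an elliptic curve (`Δ = -2816 ≠ 0`). [cite: CremonaAlgorithms1997, Table 1] -/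
theorem isElliptic_44A1 : (⟨0, 1, 0, 3, -1⟩ : WeierstrassCurve ℚ).IsElliptic := ⟨by
  rw [isUnit_iff_ne_zero]; norm_num [WeierstrassCurve.Δ, WeierstrassCurve.b₂, WeierstrassCurve.b₄, WeierstrassCurve.b₆, WeierstrassCurve.b₈]⟩

/-- `44A1` is GLOBALLY MINIMAL (`|Δ| = 2816`: `v_p Δ < 12` at every prime; Kraus at `2`, Silverman at odd `p`).
[cite: SilvermanAEC2009, VII.1 Remark 1.1] [cite: Kraus1989, Prop. 1 and Prop. 2] -/
theorem isGloballyMinimal_44A1 : (⟨0, 1, 0, 3, -1⟩ : WeierstrassCurve ℚ).IsGloballyMinimal :=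
  isGloballyMinimal_of_krausCriterion_support (0) (1) (0) (3) (-1) [(2, 0, 8), (11, 0, 1)]
    (by intro t ht; simp only [List.mem_cons, List.not_mem_nil, or_false] at ht
        rcases ht with rfl | rfl <;> norm_num)
    (by decide +kernel) (by decide +kernel)

/-- `Δ(44A1) = -2816` on the integer model. [cite: CremonaAlgorithms1997, Table 1] -/
theorem M44A1_Δ : (⟨0, 1, 0, 3, -1⟩ : WeierstrassCurve ℤ).Δ = -2816 := by decide +kernel
/-- `c₄(44A1) = -128` on the integer model. [cite: CremonaAlgorithms1997, Table 1] -/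
theorem M44A1_c₄ : (⟨0, 1, 0, 3, -1⟩ : WeierstrassCurve ℤ).c₄ = -128 := by decide +kernel
/-- `Δ(44A1) < 0` (rational model). [cite: CremonaAlgorithms1997, Table 1] -/
theorem Δ_sign_44A1 : (⟨0, 1, 0, 3, -1⟩ : WeierstrassCurve ℚ).Δ < 0 := by
  norm_num [WeierstrassCurve.Δ, WeierstrassCurve.b₂, WeierstrassCurve.b₄, WeierstrassCurve.b₆, WeierstrassCurve.b₈]

/-- The integer model of `44A1` is Cremona's. [cite: SilvermanAEC2009, VIII.8] -/
theorem intModel_44A1 :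
    haveI := isElliptic_44A1; haveI := isGloballyMinimal_44A1
    integralModelInt (⟨0, 1, 0, 3, -1⟩ : WeierstrassCurve ℚ) = (⟨0, 1, 0, 3, -1⟩ : WeierstrassCurve ℤ) :=
  haveI := isElliptic_44A1; haveI := isGloballyMinimal_44A1
  integralModelInt_eq_of_map_eq _ (by ext <;> simp [WeierstrassCurve.map])

/-- `b₂, b₄, b₆` of `44A1`. [cite: SilvermanAEC2009, III.1] -/
theorem b_44A1 : (⟨0, 1, 0, 3, -1⟩ : WeierstrassCurve ℚ).b₂ = ((4 : ℤ) : ℚ) ∧ (⟨0, 1, 0, 3, -1⟩ : WeierstrassCurve ℚ).b₄ = ((6 : ℤ) : ℚ) ∧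
    (⟨0, 1, 0, 3, -1⟩ : WeierstrassCurve ℚ).b₆ = ((-4 : ℤ) : ℚ) := by
  simp only [WeierstrassCurve.b₂, WeierstrassCurve.b₄, WeierstrassCurve.b₆]; norm_num

/-- **`E[2]` irreducible for `44A1`** (`E[2](ℚ) = 0`): the monic `2`-division cubic `X³ + b₂X² + 8b₄X + 16b₆` has no root
modulo `3`. [cite: SilvermanAEC2009, III.2.3 (b)] [cite: Zhai2016, Thm. 1.1 (hypothesis E[2](ℚ) = 0)] -/
theorem irr_two_44A1 :
    haveI := isElliptic_44A1
    Irr (⟨0, 1, 0, 3, -1⟩ : WeierstrassCurve ℚ) 2 :=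
  haveI := isElliptic_44A1
  irr_two_of_forall_cubic_ne _ b_44A1.1 b_44A1.2.1 b_44A1.2.2 (ℓ := 3) (by decide)

/-- **`ord₂ j(44A1) = 13`** (`2⁴ ∥ c₄ = -128`, `2^8 ∥ Δ`): OUTSIDE the window `[1, 11]`: additivity of the twists comes from `habitat_twist_of_addv` instead. [cite: SilvermanAEC2009, III.1 and VII.5 Prop. 5.5] -/
theorem padicValRat_j_44A1 :
    haveI := isElliptic_44A1
    padicValRat 2 (⟨0, 1, 0, 3, -1⟩ : WeierstrassCurve ℚ).j = 13 := by
  haveI : Fact (Nat.Prime 2) := ⟨Nat.prime_two⟩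
  haveI := isElliptic_44A1; haveI := isGloballyMinimal_44A1
  rw [AdditivePotMult.padicValRat_j_eq_of_intModel intModel_44A1 2 7 8 (by rw [M44A1_c₄]; decide) (by rw [M44A1_c₄]; decide)
    (by rw [M44A1_Δ]; decide) (by rw [M44A1_Δ]; decide)]
  norm_num

/-- **`N(44A1) ∣ |Δ_min| = 2816`** (the conductor divides the minimal discriminant). [cite: SilvermanAEC2009, VIII.11 and C.16] -/
theorem conductorNorm_dvd_44A1 :
    haveI := isElliptic_44A1
    (⟨0, 1, 0, 3, -1⟩ : WeierstrassCurve ℚ).conductorNorm ℤ ∣ 2816 := by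
  haveI := isElliptic_44A1; haveI := isGloballyMinimal_44A1
  have hdvd := WeierstrassCurve.conductorNorm_dvd_minimalDiscriminantNorm (⟨0, 1, 0, 3, -1⟩ : WeierstrassCurve ℚ)
    (WeierstrassCurve.finite_setOf_ordMinimalDiscriminant_ne_zero_holds _)
  rw [WeierstrassCurve.minimalDiscriminantNorm_int_eq_natAbs_minimalDiscriminantInt_holds,
    minimalDiscriminantInt_eq intModel_44A1, M44A1_Δ] at hdvd
  exact hdvd

/-- **`N(44A1) ≤ 130000`** (`N ∣ 2816`; Cremona: `N = 44`, not needed) — the level bound feeding Agashe–Ribet–Stein Thm. 2.6.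
[cite: AgasheRibetStein2006, Thm. 2.6] -/
theorem conductorNorm_le_44A1 :
    haveI := isElliptic_44A1
    (⟨0, 1, 0, 3, -1⟩ : WeierstrassCurve ℚ).conductorNorm ℤ ≤ 130000 :=
  le_trans (Nat.le_of_dvd (by norm_num) conductorNorm_dvd_44A1) (by norm_num)
/-- **`44A1` is non-CM**: multiplicative at `11` (`11 ∣ Δ`, `11 ∤ c₄`), so `ord_11 j < 0` and `j` is not a CM invariant. [cite: SilvermanAEC2009, App. C §11] -/
theorem not_hasCM_44A1 :
    haveI := isElliptic_44A1
    ¬ (⟨0, 1, 0, 3, -1⟩ : WeierstrassCurve ℚ).HasCM := by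
  haveI : Fact (Nat.Prime 2) := ⟨Nat.prime_two⟩
  haveI := isElliptic_44A1; haveI := isGloballyMinimal_44A1
  haveI : Fact (Nat.Prime 11) := ⟨by norm_num⟩
  exact AdditivePotMult.not_hasCM_of_padicValRat_j_neg (p := 11) (EisensteinPrimes.padicValRat_j_neg_of_mult _ 11
    (hasMultiplicativeReductionAtPrime_of_intModel intModel_44A1 11 (by rw [M44A1_Δ]; decide) (by rw [M44A1_c₄]; decide)))

/-- **`44A1` is ADDITIVE at `2`** (`2 ∣ Δ`, `2 ∣ c₄` on the minimal model; Kodaira `IV*`). [cite: SilvermanAEC2009, VII.5 Prop. 5.1 (c)] -/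
theorem addv_two_44A1 :
    haveI := isElliptic_44A1; haveI := isGloballyMinimal_44A1; haveI : Fact (Nat.Prime 2) := ⟨Nat.prime_two⟩
    Addv (⟨0, 1, 0, 3, -1⟩ : WeierstrassCurve ℚ) 2 := by
  haveI : Fact (Nat.Prime 2) := ⟨Nat.prime_two⟩
  haveI := isElliptic_44A1; haveI := isGloballyMinimal_44A1
  exact Additive.addv_of_intModel intModel_44A1 2 (by rw [M44A1_Δ]; decide) (by rw [M44A1_c₄]; decide)

/-- **THE ZHAI-1.1 ROAD AT THE BASE `44A1`** (`ord₂ j = 13`, off the `j`-window; habitat by `habitat_twist_of_addv`): for every `M` as in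
Zhai 2016 Thm. 1.1 (square-free, `M ≡ 1 (mod 4)`, `(M, N) = 1`, `r ≥ 1` odd prime factors all inert in the cubic `2`-division field) and
every global minimal `W ≅ 44A1^{(M)}`: `r_an(W) = 0`, `W` ADDITIVE and POTENTIALLY GOOD at `2`, NON-CM, `W[2]` IRREDUCIBLE, and the LOWER
half `MissingLowerBoundAt W 2` HOLDS. KERNEL: ellipticity, global minimality, `Δ < 0`, `E[2]` irreducible, `Addv` at `2`, `ord₂ j = 13`,
non-CM (multiplicative at `11`), `N ∣ 2816`. DISPLAYED: the `X₀(44)`-optimality datum (`Dt`, `hopt`) and the record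
`ord₂(L(44A1,1)/Ω_∞) = 0` (Cremona 1992 Tables 1 and 4: `r = 0`, `#T = 3`, `c_p = (3, 1)`, `S = 1`, `L/Ω_BSD = 3/9`, `Δ < 0`). By name:
Zhai 2016 Thm. 1.1 (corrected), Agashe–Ribet–Stein Thm. 2.6, modularity. BSD is not proved by any of this.
[cite: Zhai2016, Thm. 1.1] [cite: AgasheRibetStein2006, Thm. 2.6] [cite: CremonaAlgorithms1997, Table 1 and Table 4] [cite: Miller2011LMS, Def. 1.1] -/
theorem printFamily44A1_lower (h11 : thm11_ordTwo_LAlg_twist_eq_zero')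
    (h26 : cremona_abs_maninConstant_eq_one_of_level_le) (hmod : hasEntireLFunction_rat)
    [hN : haveI := isElliptic_44A1; NeZero ((⟨0, 1, 0, 3, -1⟩ : WeierstrassCurve ℚ).conductorNorm ℤ)]
    (Dt : haveI := isElliptic_44A1; ModularParametrizationData (⟨0, 1, 0, 3, -1⟩ : WeierstrassCurve ℚ) ((⟨0, 1, 0, 3, -1⟩ : WeierstrassCurve ℚ).conductorNorm ℤ))
    (hopt : haveI := isElliptic_44A1; Zhai2021.IsOptimalDatum (⟨0, 1, 0, 3, -1⟩ : WeierstrassCurve ℚ) Dt)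
    (hL : haveI := isElliptic_44A1; ∃ x : ℚ, IsLAlg (⟨0, 1, 0, 3, -1⟩ : WeierstrassCurve ℚ) x ∧ x ≠ 0 ∧ padicValRat 2 x = 0)
    (F : Type) [Field F] [NumberField F] (hF : IsTwoDivisionField (⟨0, 1, 0, 3, -1⟩ : WeierstrassCurve ℚ) F)
    (M : ℤ) (hsq : Squarefree M) (hM4 : M % 4 = 1)
    (hgcd : haveI := isElliptic_44A1; Int.gcd M ((⟨0, 1, 0, 3, -1⟩ : WeierstrassCurve ℚ).conductorNorm ℤ) = 1)
    (hne : M.natAbs.primeFactors.Nonempty) (hin : ∀ q ∈ M.natAbs.primeFactors, q ≠ 2 ∧ IsInertIn F q)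
    (W : WeierstrassCurve ℚ) [W.IsElliptic] [W.IsGloballyMinimal]
    (hW : ∃ C : VariableChange ℚ, C • (⟨0, 1, 0, 3, -1⟩ : WeierstrassCurve ℚ).quadraticTwist (M : ℚ) = W) :
    haveI : Fact (Nat.Prime 2) := ⟨Nat.prime_two⟩
    W.analyticRank = 0 ∧ Addv W 2 ∧ 0 ≤ padicValRat 2 W.j ∧ ¬ W.HasCM ∧ Irr W 2 ∧ MissingLowerBoundAt W 2 := by
  haveI := isElliptic_44A1; haveI := isGloballyMinimal_44A1
  exact printFamilyZhai11'_lower_of_addv h11 h26 hmod _ conductorNorm_le_44A1 Dt hopt Δ_sign_44A1 irr_two_44A1 addv_two_44A1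
    (by rw [padicValRat_j_44A1]; norm_num) not_hasCM_44A1 hL F hF M hsq hM4 hgcd hne hin W hW

end Base44A1

end Summit.BirchSwinnertonDyer.BirchSwinnertonDyer.Theorems.AddPotGoodPrint

end
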